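import Literature.AlgebraicGeometry.HodgeTheory.HypersurfaceSectionComplementMorse
import Literature.AlgebraicGeometry.HodgeTheory.HypersurfaceJacobian
import Literature.AlgebraicGeometry.HodgeTheory.ShiodaClaimPairedProofs
import Literature.AlgebraicGeometry.Motives.SplitQuadricNormalForm
import Literature.AlgebraicGeometry.Motives.LinesGenerateChowOneLinear
import Literature.AlgebraicGeometry.Motives.GeneralNonsingularForms
import HarnessLib

/-!
# The two rulings of a smooth even-dimensional quadric (algebra and scheme-theoretic glue)

Family `hodge`, layer `Literature/AlgebraicGeometry/HodgeTheory`. THEOREMS ONLY (no definition, no named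
fact), sub-namespace `…HodgeTheory.SplitQuadric`. Glue between the topological core
`SplitQuadricComplementRetraction` and the assembly `QuadricHypersurfaceHodgeConjecture` (the Hodge
conjecture for smooth quadrics):

* `exists_linearMap_of_linearSubst` — an invertible linear substitution `σ_τ` of `ℂ[x₀, …, x_M]` and its
  inverse as mutually inverse linear maps `Φ v = (τᵢ(v))ᵢ`, `Ψ`;
* `exists_rulingCoordinates` — for the split normal form in the new coordinates `Φ`: the odd / even
  coordinate projections `T`, `L : ℂ^{2k+2} → ℂ^{k+1}` with sections `S`, `S₂` (`{L = 0} = S(ℂ^{k+1})`),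
  under which the straight-line deformation `blend t v = S(Tv) + t(v − S(Tv))` keeps the odd
  coordinates and scales the even ones by `t`; `eval_splitForm_of_odd_even` — so the split quadric
  `Σᵢ x_{2i} x_{2i+1}` scales by `t` (the hypothesis `q(blend t v) = t·q(v)` of the topological core);
* `isNonsingularSystem_of_isHypersurfaceCutOutBy` — a smooth hypersurface satisfies the Jacobian
  condition (discharged criterion `Hartshorne1977_smoothHypersurface_jacobian_holds` + Nullstellensatz),
  the input of the tree's split normal form `exists_linearSubst_splitForm`;
* `le_coheight_of_mem_zeroLocus_rulingForms` — the ruling `Λ = X ∩ V₊(L₀, …, L_k)` has codimension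
  `≥ k` pointwise (tree: `le_coheight_add_of_mem_zeroLocus_linearForms`);
* `pt_notMem_preimage_zeroLocus_iff`, `exists_homeomorph_complexPointsCompl_quadricCompl` — the complex
  points of `X` off `Λ` (the carrier of `supportedClasses`) are homeomorphic, through Serre's
  comparison `hypersurfacePoint`, to the open piece `{F = 0, T ≠ 0}` of the projective quadric.

Provenance: Literature home of the Summits-side
`Theorems/LimitExtensionHypersurfaceHodgeFourLowDegreeQuadricRulings` (route `LimitExtension`, item
`HypersurfaceHodgeFourLowDegree`, stmt-HodgeConjecture-3003), which `Literature/` may not import. Lane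
`lit-hodgefound`, seat p20.

## References

* [GriffithsHarrisPrinciples1978] P. Griffiths, J. Harris, Principles of Algebraic Geometry (1978),
  Ch. 6 §1 (linear spaces on quadrics).
* [Hartshorne1977] R. Hartshorne, Algebraic Geometry (1977), I Ex. 5.8, I Ex. 2.11, II Prop. 2.5,
  II Ex. 3.20.
* [SerreGAGA1956] J.-P. Serre, GAGA, Ann. Inst. Fourier 6 (1956), §2 n°5 Prop. 2.
-/

noncomputable section

open scoped LinearAlgebra.Projectivization
open CategoryTheory CategoryTheory.Limits Topology AlgebraicGeometry MvPolynomial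
open Literature.AlgebraicTopology.SingularHomology
open Literature.AlgebraicGeometry.HodgeTheory Literature.AlgebraicGeometry.Motives
  Literature.AlgebraicGeometry.Motives.ProjectiveSpaceCells
open Literature.NumberTheory.Transcendental (projPoint isHomeomorph_projPoint projPoint_injective
  pt_projPoint_mk_mem_basicOpen_iff)

namespace Literature.AlgebraicGeometry.HodgeTheory.SplitQuadric

section Algebra

variable {M : ℕ}

/-- A linear form evaluates as the dot product with its coefficient vector.
[cite: Hartshorne1977, I Ex. 2.11] -/
theorem eval_eq_dotProduct_of_isHomogeneous_one {f : MvPolynomial (Fin (M + 1)) ℂ}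
    (hf : f.IsHomogeneous 1) (v : Fin (M + 1) → ℂ) :
    eval v f = (fun j ↦ coeff (Finsupp.single j 1) f) ⬝ᵥ v := by
  conv_lhs => rw [eq_lin_of_isHomogeneous_one hf]
  exact eval_lin _ _

/-- **An invertible linear substitution and its inverse as mutually inverse linear maps**: for linear
forms `τⱼ`, `τ'ⱼ` with `σ_τ ∘ σ_{τ'} = id = σ_{τ'} ∘ σ_τ` on `ℂ[x₀, …, x_M]`, the maps
`Φ v = (τᵢ(v))ᵢ` and `Ψ u = (τ'ᵢ(u))ᵢ` are linear and inverse to each other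
(`τ'ᵢ(τ₀(v), …, τ_M(v)) = (σ_τ τ'ᵢ)(v) = xᵢ(v)`). [cite: GriffithsHarrisPrinciples1978, Ch. 6 §1] -/
theorem exists_linearMap_of_linearSubst (τ τ' : Fin (M + 1) → MvPolynomial (Fin (M + 1)) ℂ)
    (hτ : ∀ j, (τ j).IsHomogeneous 1) (hτ' : ∀ j, (τ' j).IsHomogeneous 1)
    (hinv : ∀ p, aeval τ (aeval τ' p) = p) (hinv' : ∀ p, aeval τ' (aeval τ p) = p) :
    ∃ Φ Ψ : (Fin (M + 1) → ℂ) →ₗ[ℂ] (Fin (M + 1) → ℂ),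
      (∀ v i, Φ v i = eval v (τ i)) ∧ (∀ u i, Ψ u i = eval u (τ' i)) ∧
        (∀ u, Φ (Ψ u) = u) ∧ (∀ v, Ψ (Φ v) = v) := by
  let A : Matrix (Fin (M + 1)) (Fin (M + 1)) ℂ := Matrix.of fun i j ↦ coeff (Finsupp.single j 1) (τ i)
  let B : Matrix (Fin (M + 1)) (Fin (M + 1)) ℂ := Matrix.of fun i j ↦ coeff (Finsupp.single j 1) (τ' i)
  have hΦ : ∀ v i, Matrix.mulVecLin A v i = eval v (τ i) := fun v i ↦ by
    rw [Matrix.mulVecLin_apply, eval_eq_dotProduct_of_isHomogeneous_one (hτ i)]; rfl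
  have hΨ : ∀ u i, Matrix.mulVecLin B u i = eval u (τ' i) := fun u i ↦ by
    rw [Matrix.mulVecLin_apply, eval_eq_dotProduct_of_isHomogeneous_one (hτ' i)]; rfl
  -- `g(f₀(w), …, f_M(w)) = (σ_f g)(w)`
  have hcomp : ∀ (f : Fin (M + 1) → MvPolynomial (Fin (M + 1)) ℂ) (g : MvPolynomial (Fin (M + 1)) ℂ)
      (w : Fin (M + 1) → ℂ), eval (fun j ↦ eval w (f j)) g = eval w (aeval f g) := fun f g w ↦ by
    rw [MvPolynomial.aeval_eq_bind₁]
    exact (MvPolynomial.eval₂Hom_bind₁ _ _ _ _).symm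
  refine ⟨Matrix.mulVecLin A, Matrix.mulVecLin B, hΦ, hΨ, fun u ↦ funext fun i ↦ ?_,
    fun v ↦ funext fun i ↦ ?_⟩
  · rw [hΦ, show (Matrix.mulVecLin B u) = fun j ↦ eval u (τ' j) from funext (hΨ u), hcomp,
      show aeval τ' (τ i) = X i by simpa only [aeval_X] using hinv' (X i), eval_X]
  · rw [hΨ, show (Matrix.mulVecLin A v) = fun j ↦ eval v (τ j) from funext (hΦ v), hcomp,
      show aeval τ (τ' i) = X i by simpa only [aeval_X] using hinv (X i), eval_X]

variable {k : ℕ}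

/-- **The two rulings' coordinates.** Given mutually inverse linear maps `Φ`, `Ψ` of `ℂ^{2k+2}`
(the substitution of the split normal form and its inverse), there are continuous linear maps
`T v = (Φ(v)_{2j+1})ⱼ`, `L v = (Φ(v)_{2j})ⱼ : ℂ^{2k+2} → ℂ^{k+1}` (the odd and the even new
coordinates) with continuous sections `S`, `S₂` (`Ψ` of the vector with the given odd, resp. even,
coordinates and zeros elsewhere) such that `{L = 0} = S(ℂ^{k+1})` (`L v = 0 ↔ S(Tv) = v`) and the
straight-line deformation `blend t v = S(Tv) + t(v − S(Tv))` keeps the odd new coordinates and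
scales the even ones by `t`. [cite: GriffithsHarrisPrinciples1978, Ch. 6 §1] -/
theorem exists_rulingCoordinates (Φ Ψ : (Fin (2 * k + 1 + 1) → ℂ) →ₗ[ℂ] (Fin (2 * k + 1 + 1) → ℂ))
    (hΦΨ : ∀ u, Φ (Ψ u) = u) (hΨΦ : ∀ v, Ψ (Φ v) = v) :
    ∃ (T : (Fin (2 * k + 1 + 1) → ℂ) →L[ℂ] (Fin (k + 1) → ℂ)) (S : (Fin (k + 1) → ℂ) →L[ℂ] (Fin (2 * k + 1 + 1) → ℂ))
      (L : (Fin (2 * k + 1 + 1) → ℂ) →L[ℂ] (Fin (k + 1) → ℂ)) (S₂ : (Fin (k + 1) → ℂ) →L[ℂ] (Fin (2 * k + 1 + 1) → ℂ)),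
      (∀ v j, T v j = Φ v ⟨2 * j + 1, by omega⟩) ∧ (∀ v j, L v j = Φ v ⟨2 * j, by omega⟩) ∧
      (∀ w, T (S w) = w) ∧ (∀ w, L (S₂ w) = w) ∧ (∀ v, L v = 0 ↔ S (T v) = v) ∧
      ∀ (t : ℝ) (v : Fin (2 * k + 1 + 1) → ℂ) (i : Fin (2 * k + 1 + 1)),
        Φ (blend (T : (Fin (2 * k + 1 + 1) → ℂ) →ₗ[ℂ] (Fin (k + 1) → ℂ))
            (S : (Fin (k + 1) → ℂ) →ₗ[ℂ] (Fin (2 * k + 1 + 1) → ℂ)) t v) i =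
          if (i : ℕ) % 2 = 1 then Φ v i else (t : ℂ) * Φ v i := by
  -- index bookkeeping: odd slots `2j+1`, even slots `2j`, and halving
  let e₁ : Fin (k + 1) → Fin (2 * k + 1 + 1) := fun j ↦ ⟨2 * j + 1, by omega⟩
  let e₀ : Fin (k + 1) → Fin (2 * k + 1 + 1) := fun j ↦ ⟨2 * j, by omega⟩
  let hf : Fin (2 * k + 1 + 1) → Fin (k + 1) := fun i ↦ ⟨i / 2, by omega⟩
  have he₁ : ∀ j, ((e₁ j : Fin (2 * k + 1 + 1)) : ℕ) = 2 * j + 1 := fun j ↦ rfl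
  have he₀ : ∀ j, ((e₀ j : Fin (2 * k + 1 + 1)) : ℕ) = 2 * j := fun j ↦ rfl
  have hhf : ∀ i, ((hf i : Fin (k + 1)) : ℕ) = i / 2 := fun i ↦ rfl
  have h1 : ∀ i : Fin (2 * k + 1 + 1), (i : ℕ) % 2 = 1 → e₁ (hf i) = i :=
    fun i hi ↦ Fin.ext (by rw [he₁, hhf]; omega)
  have h0 : ∀ i : Fin (2 * k + 1 + 1), ¬ (i : ℕ) % 2 = 1 → e₀ (hf i) = i :=
    fun i hi ↦ Fin.ext (by rw [he₀, hhf]; omega)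
  have h1' : ∀ j, hf (e₁ j) = j := fun j ↦ Fin.ext (by rw [hhf, he₁]; omega)
  have h0' : ∀ j, hf (e₀ j) = j := fun j ↦ Fin.ext (by rw [hhf, he₀]; omega)
  have hp1 : ∀ j, ((e₁ j : Fin (2 * k + 1 + 1)) : ℕ) % 2 = 1 := fun j ↦ by rw [he₁]; omega
  have hp0 : ∀ j, ¬ ((e₀ j : Fin (2 * k + 1 + 1)) : ℕ) % 2 = 1 := fun j ↦ by rw [he₀]; omega
  -- interleaving: a vector of `ℂ^{k+1}` placed at the odd, resp. even, slots
  let J₁ : (Fin (k + 1) → ℂ) →ₗ[ℂ] (Fin (2 * k + 1 + 1) → ℂ) :=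
    { toFun := fun w i ↦ if (i : ℕ) % 2 = 1 then w (hf i) else 0
      map_add' := fun w w' ↦ funext fun i ↦ by simp only [Pi.add_apply]; split_ifs <;> simp
      map_smul' := fun c w ↦ funext fun i ↦ by
        simp only [Pi.smul_apply, smul_eq_mul, RingHom.id_apply]; split_ifs <;> simp }
  let J₀ : (Fin (k + 1) → ℂ) →ₗ[ℂ] (Fin (2 * k + 1 + 1) → ℂ) :=
    { toFun := fun w i ↦ if (i : ℕ) % 2 = 1 then 0 else w (hf i)
      map_add' := fun w w' ↦ funext fun i ↦ by simp only [Pi.add_apply]; split_ifs <;> simp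
      map_smul' := fun c w ↦ funext fun i ↦ by
        simp only [Pi.smul_apply, smul_eq_mul, RingHom.id_apply]; split_ifs <;> simp }
  have hJ₁ : ∀ w i, J₁ w i = if (i : ℕ) % 2 = 1 then w (hf i) else 0 := fun _ _ ↦ rfl
  have hJ₀ : ∀ w i, J₀ w i = if (i : ℕ) % 2 = 1 then 0 else w (hf i) := fun _ _ ↦ rfl
  -- the odd / even coordinate projections and their sections
  let T : (Fin (2 * k + 1 + 1) → ℂ) →L[ℂ] (Fin (k + 1) → ℂ) :=
    LinearMap.toContinuousLinearMap (LinearMap.funLeft ℂ ℂ e₁ ∘ₗ Φ)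
  let L : (Fin (2 * k + 1 + 1) → ℂ) →L[ℂ] (Fin (k + 1) → ℂ) :=
    LinearMap.toContinuousLinearMap (LinearMap.funLeft ℂ ℂ e₀ ∘ₗ Φ)
  let S : (Fin (k + 1) → ℂ) →L[ℂ] (Fin (2 * k + 1 + 1) → ℂ) := LinearMap.toContinuousLinearMap (Ψ ∘ₗ J₁)
  let S₂ : (Fin (k + 1) → ℂ) →L[ℂ] (Fin (2 * k + 1 + 1) → ℂ) := LinearMap.toContinuousLinearMap (Ψ ∘ₗ J₀)
  have hT : ∀ v j, T v j = Φ v (e₁ j) := fun _ _ ↦ rfl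
  have hL : ∀ v j, L v j = Φ v (e₀ j) := fun _ _ ↦ rfl
  have hS : ∀ w, Φ (S w) = J₁ w := fun w ↦ hΦΨ _
  have hS₂ : ∀ w, Φ (S₂ w) = J₀ w := fun w ↦ hΦΨ _
  -- `Φ(S(Tv))`: the odd coordinates of `Φ v`, zeros at the even slots
  have hSTv : ∀ v i, Φ (S (T v)) i = if (i : ℕ) % 2 = 1 then Φ v i else 0 := fun v i ↦ by
    rw [hS, hJ₁]
    split_ifs with hi
    · rw [hT, h1 i hi]
    · rfl
  refine ⟨T, S, L, S₂, hT, hL, fun w ↦ funext fun j ↦ ?_, fun w ↦ funext fun j ↦ ?_,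
    fun v ↦ ⟨fun hL0 ↦ ?_, fun h ↦ funext fun j ↦ ?_⟩, fun t v i ↦ ?_⟩
  · -- `T (S w) = w`
    rw [hT, hS, hJ₁, if_pos (hp1 j), h1']
  · -- `L (S₂ w) = w`
    rw [hL, hS₂, hJ₀, if_neg (hp0 j), h0']
  · -- `L v = 0 → S (T v) = v`: compare the new coordinates
    have hΦeq : Φ (S (T v)) = Φ v := funext fun i ↦ by
      rw [hSTv]
      split_ifs with hi
      · rfl
      · have hLi : L v (hf i) = 0 := by rw [hL0]; rfl
        rw [hL, h0 i hi] at hLi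
        exact hLi.symm
    have := congrArg Ψ hΦeq
    rwa [hΨΦ, hΨΦ] at this
  · -- `S (T v) = v → L v = 0`
    rw [hL, ← h, hSTv, if_neg (hp0 j)]
    rfl
  · -- the deformation in the new coordinates
    simp only [blend, ContinuousLinearMap.coe_coe, map_add, map_smul, map_sub, Pi.add_apply,
      Pi.smul_apply, Pi.sub_apply, smul_eq_mul, hSTv]
    split_ifs <;> ring

/-- **The split quadric scales by `t` under the deformation**: if the odd coordinates of `u'` are
those of `u` and the even ones are `t` times those of `u`, then
`splitForm(u') = Σᵢ u'_{2i} u'_{2i+1} = t · splitForm(u)` (an even number `2k + 2` of variables, so the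
split form has no square term). [cite: GriffithsHarrisPrinciples1978, Ch. 6 §1] -/
theorem eval_splitForm_of_odd_even (t : ℂ) (u u' : Fin (2 * k + 1 + 1) → ℂ)
    (h : ∀ i : Fin (2 * k + 1 + 1), u' i = if (i : ℕ) % 2 = 1 then u i else t * u i) :
    eval u' (splitForm ℂ (2 * k + 1)) = t * eval u (splitForm ℂ (2 * k + 1)) := by
  rw [eval_splitForm, eval_splitForm, Finset.mul_sum]
  refine Finset.sum_congr rfl fun i _ ↦ ?_
  by_cases hi : (i : ℕ) % 2 = 0
  · rw [if_pos hi, if_pos hi]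
    have hi' : (i : ℕ) + 1 < 2 * k + 1 + 1 := by have := i.2; omega
    rw [dif_pos hi', dif_pos hi', h i, if_neg (by omega), h ⟨(i : ℕ) + 1, hi'⟩, if_pos (show ((⟨(i : ℕ) + 1, hi'⟩ : Fin (2 * k + 1 + 1)) : ℕ) % 2 = 1 by simp only; omega)]
    ring
  · rw [if_neg hi, if_neg hi, mul_zero]

end Algebra

/-! ### Scheme side: the Jacobian criterion, the ruling `Λ = V(odd forms) ∩ X`, its codimension, and `(X ∖ Λ)(ℂ)` -/

section Scheme

/-- **A smooth hypersurface satisfies the Jacobian condition** (as the tree's `IsNonsingularSystem`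
of the one-member family): the discharged Jacobian criterion
`Hartshorne1977_smoothHypersurface_jacobian_holds` (no non-zero common zero of `F` and its partials)
and the Nullstellensatz half `SmoothHypersurface.isNonsingularForm_of_forall_exists_eval_pderiv_ne_zero`.
[cite: Hartshorne1977, I Ex. 5.8 and III Ex. 10.0.3] -/
theorem isNonsingularSystem_of_isHypersurfaceCutOutBy {n d : ℕ} {X : SchemeOver ℂ}
    (hX : IsSmoothProjective n X) {F : MvPolynomial (Fin (n + 2)) ℂ} (hF : F.IsHomogeneous d)
    (hirr : Irreducible F) (hcut : IsHypersurfaceCutOutBy (n + 1) F X) :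
    IsNonsingularSystem ℂ (fun _ : Fin 1 ↦ F) :=
  (isNonsingularSystem_const_iff F).2
    (SmoothHypersurface.isNonsingularForm_of_forall_exists_eval_pderiv_ne_zero
      (Hartshorne1977_smoothHypersurface_jacobian_holds n d X F hX hF hirr hcut))

variable {k : ℕ} {X : SchemeOver ℂ}

/-- **A linear `ℙᵏ` on a `2k`-fold has codimension `≥ k` pointwise**: for `X` smooth projective
of dimension `2k` with a closed immersion `ι : X ↪ ℙ^{2k+1}_ℂ` and `k + 1` independent linear forms
`L₀, …, L_k`, every point `z ∈ X` with `ι(z) ∈ V₊(L₀, …, L_k)` has `coheight z ≥ k` (the tree's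
`le_coheight_add_of_mem_zeroLocus_linearForms`: `2k ≤ coheight z + (2k + 1 − (k + 1))`).
[cite: Hartshorne1977, I Ex. 2.11 and II Ex. 3.20] -/
theorem le_coheight_of_mem_zeroLocus_rulingForms (hX : IsSmoothProjective (2 * k) X)
    (ι : X ⟶ projectiveSpace (2 * k + 1) ℂ) [IsClosedImmersion ι.left]
    (L : Fin (k + 1) → MvPolynomial (Fin (2 * k + 1 + 1)) ℂ) (hL : LinearIndependent ℂ L)
    (hhom : ∀ j, (L j).IsHomogeneous 1) {z : X.left}
    (hz : letI := MvPolynomial.gradedAlgebra (σ := Fin (2 * k + 1 + 1)) (R := ℂ)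
      ι.left.base z ∈ ProjectiveSpectrum.zeroLocus
        (MvPolynomial.homogeneousSubmodule (Fin (2 * k + 1 + 1)) ℂ) (Set.range L)) :
    ((k : ℕ) : ℕ∞) ≤ Order.coheight z := by
  have h := le_coheight_add_of_mem_zeroLocus_linearForms hX ι L hL hhom (by omega) hz
  rw [show (2 * k + 1 - (k + 1) : ℕ) = k by omega] at h
  generalize Order.coheight z = c at h ⊢
  induction c using ENat.recTopCoe with
  | top => exact le_top
  | coe m =>
    have h' : ((2 * k : ℕ) : ℕ∞) ≤ ((m + k : ℕ) : ℕ∞) := by rwa [Nat.cast_add]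
    have h'' := ENat.coe_le_coe.1 h'
    exact ENat.coe_le_coe.2 (by omega)

/-- **The complex points of `X` off `Λ = X ∩ V₊(L₀, …, L_k)` are those with some `Lⱼ ≠ 0`** in the
homogeneous coordinates `hypersurfacePoint ι P` (`[z] ∈ D₊(g) ↔ g(z) ≠ 0`,
`pt_projPoint_mk_mem_basicOpen_iff`). [cite: Hartshorne1977, II Prop. 2.5] -/
theorem pt_notMem_preimage_zeroLocus_iff (ι : X ⟶ projectiveSpace (2 * k + 1) ℂ)
    {t : ℕ} (L : Fin t → MvPolynomial (Fin (2 * k + 1 + 1)) ℂ) (hhom : ∀ j, (L j).IsHomogeneous 1)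
    (P : ComplexPoints X) :
    letI := MvPolynomial.gradedAlgebra (σ := Fin (2 * k + 1 + 1)) (R := ℂ)
    P.pt ∉ ι.left.base ⁻¹' ProjectiveSpectrum.zeroLocus
        (MvPolynomial.homogeneousSubmodule (Fin (2 * k + 1 + 1)) ℂ) (Set.range L) ↔
      ∃ j, eval (hypersurfacePoint ι P).rep (L j) ≠ 0 := by
  letI := MvPolynomial.gradedAlgebra (σ := Fin (2 * k + 1 + 1)) (R := ℂ)
  have h1 : ι.left.base P.pt = (projPoint (2 * k + 1) (Projectivization.mk ℂ (hypersurfacePoint ι P).rep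
      (hypersurfacePoint ι P).rep_nonzero)).pt := by
    rw [Projectivization.mk_rep, projPoint_hypersurfacePoint]; rfl
  have key : ∀ j, L j ∈ (ι.left.base P.pt).asHomogeneousIdeal ↔
      eval (hypersurfacePoint ι P).rep (L j) = 0 := fun j ↦ by
    rw [h1]
    have h2 := pt_projPoint_mk_mem_basicOpen_iff (2 * k + 1) (hypersurfacePoint ι P).rep
      (hypersurfacePoint ι P).rep_nonzero one_pos ((MvPolynomial.mem_homogeneousSubmodule 1 _).2 (hhom j))
    have h3 := (Proj.mem_basicOpen _ (L j) _).symm.trans h2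
    rw [← not_iff_not]
    exact h3
  rw [Set.mem_preimage]
  change ¬ (Set.range L ⊆ _) ↔ _
  simp only [Set.range_subset_iff, not_forall]
  refine exists_congr fun j ↦ ?_
  rw [← not_iff_not, not_not, not_not]
  exact key j

/-- **`(X ∖ Λ)(ℂ) ≃ U = {[v] | F(v) = 0, T v ≠ 0}`**: for the closed immersion `ι : X ↪ ℙ^{2k+1}_ℂ`
onto `V₊(F)`, `Λ = X ∩ V₊(L₀, …, L_k)` and a linear map `T` with coordinates the forms `Lⱼ`, the
complex points of `X` off `Λ` (the carrier of the tree's `supportedClasses`) are homeomorphic, through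
Serre's comparison `hypersurfacePoint ι` (`Y(ℂ) ≃ {[z] | F(z) = 0}`), to the open piece `U` of the
projective quadric `{F = 0} ⊆ ℙ(ℂ^{2k+2})` of the topological core.
[cite: SerreGAGA1956, §2 n°5 Prop. 2] [cite: Hartshorne1977, II Prop. 2.5] -/
theorem exists_homeomorph_complexPointsCompl_quadricCompl {d : ℕ} (ι : X ⟶ projectiveSpace (2 * k + 1) ℂ)
    [IsClosedImmersion ι.left] {F : MvPolynomial (Fin (2 * k + 1 + 1)) ℂ} (hF : F.IsHomogeneous d)
    (hrange : letI := MvPolynomial.gradedAlgebra (σ := Fin (2 * k + 1 + 1)) (R := ℂ)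
      Set.range ι.left.base = ProjectiveSpectrum.zeroLocus
        (MvPolynomial.homogeneousSubmodule (Fin (2 * k + 1 + 1)) ℂ) {F})
    {t : ℕ} (L : Fin t → MvPolynomial (Fin (2 * k + 1 + 1)) ℂ) (hhom : ∀ j, (L j).IsHomogeneous 1)
    (T : (Fin (2 * k + 1 + 1) → ℂ) →ₗ[ℂ] (Fin t → ℂ)) (hT : ∀ v j, T v j = eval v (L j)) :
    letI := MvPolynomial.gradedAlgebra (σ := Fin (2 * k + 1 + 1)) (R := ℂ)
    ∃ Θ : complexPointsCompl X (ι.left.base ⁻¹' ProjectiveSpectrum.zeroLocus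
        (MvPolynomial.homogeneousSubmodule (Fin (2 * k + 1 + 1)) ℂ) (Set.range L)) ≃ₜ
      ↥({p : ℙ ℂ (Fin (2 * k + 1 + 1) → ℂ) | eval p.rep F = 0} ∩ linComplSet T),
      ∀ P, ((Θ P : ↥({p : ℙ ℂ (Fin (2 * k + 1 + 1) → ℂ) | eval p.rep F = 0} ∩ linComplSet T)) :
        ℙ ℂ (Fin (2 * k + 1 + 1) → ℂ)) = hypersurfacePoint ι P.1 := by
  letI := MvPolynomial.gradedAlgebra (σ := Fin (2 * k + 1 + 1)) (R := ℂ)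
  set Z : Set X.left := ι.left.base ⁻¹' ProjectiveSpectrum.zeroLocus
    (MvPolynomial.homogeneousSubmodule (Fin (2 * k + 1 + 1)) ℂ) (Set.range L) with hZdef
  set U : Set (ℙ ℂ (Fin (2 * k + 1 + 1) → ℂ)) :=
    {p : ℙ ℂ (Fin (2 * k + 1 + 1) → ℂ) | eval p.rep F = 0} ∩ linComplSet T with hUdef
  have hemb := isEmbedding_hypersurfacePoint ι
  have hrangeψ : Set.range (hypersurfacePoint ι) = {p | eval p.rep F = 0} := by
    rw [range_hypersurfacePoint hF hrange]
    ext p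
    simp [Projectivization.projZeroLocus]
  -- `T p.rep ≠ 0 ↔ some L_j(p.rep) ≠ 0`
  have hTne : ∀ p : ℙ ℂ (Fin (2 * k + 1 + 1) → ℂ), p ∈ linComplSet T ↔ ∃ j, eval p.rep (L j) ≠ 0 :=
    fun p ↦ by
      change T p.rep ≠ 0 ↔ _
      rw [Function.ne_iff]
      simp only [hT, Pi.zero_apply]
  have hmem : ∀ P : complexPointsCompl X Z, hypersurfacePoint ι P.1 ∈ U := fun P ↦
    ⟨by rw [← hrangeψ]; exact Set.mem_range_self _,
      (hTne _).2 ((pt_notMem_preimage_zeroLocus_iff ι L hhom P.1).1 P.2)⟩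
  let f : complexPointsCompl X Z → U := fun P ↦ ⟨hypersurfacePoint ι P.1, hmem P⟩
  let g₀ : U → Set.range (hypersurfacePoint ι) := fun u ↦ ⟨u.1, by rw [hrangeψ]; exact u.2.1⟩
  have hg₀ : ∀ u : U, hypersurfacePoint ι (hemb.toHomeomorph.symm (g₀ u)) = u.1 := fun u ↦
    congrArg Subtype.val (hemb.toHomeomorph.apply_symm_apply (g₀ u))
  have hback : ∀ u : U, (hemb.toHomeomorph.symm (g₀ u) : ComplexPoints X).pt ∉ Z := fun u ↦ by
    rw [pt_notMem_preimage_zeroLocus_iff ι L hhom, hg₀]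
    exact (hTne _).1 u.2.2
  let g : U → complexPointsCompl X Z := fun u ↦ ⟨hemb.toHomeomorph.symm (g₀ u), hback u⟩
  have hfg : ∀ u, f (g u) = u := fun u ↦ Subtype.ext (hg₀ u)
  have hgf : ∀ P, g (f P) = P := fun P ↦ by
    apply Subtype.ext
    show hemb.toHomeomorph.symm (g₀ (f P)) = P.1
    have : g₀ (f P) = hemb.toHomeomorph P.1 := Subtype.ext rfl
    rw [this, Homeomorph.symm_apply_apply]
  refine ⟨⟨⟨f, g, hgf, hfg⟩, ?_, ?_⟩, fun P ↦ rfl⟩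
  · exact ((continuous_hypersurfacePoint ι).comp continuous_subtype_val).subtype_mk _
  · exact (hemb.toHomeomorph.symm.continuous.comp (continuous_subtype_val.subtype_mk _)).subtype_mk _

end Scheme

end Literature.AlgebraicGeometry.HodgeTheory.SplitQuadric

end
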